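import Literature.NumberTheory.LFunctions.HalfIsolatedZeroDerivBounds
import Mathlib.Analysis.MellinTransform
import Mathlib.Analysis.Complex.ExponentialBounds
import Mathlib.MeasureTheory.Integral.IntervalIntegral.IntegrationByParts
import Mathlib.Analysis.SpecialFunctions.Integrals.Basic
import HarnessLib

/-!
# Half-isolated zeros (Maynard–Pratt 2024), III: the Mellin transform `W₀` of `w₀`

Topic `Literature/NumberTheory/LFunctions`. Everything in this file is PROVED (no definition, no
named fact). Second half of the in-tree proof of the analytic part of **Lemma 43** (p. 25) of

* J. Maynard, K. Pratt, *Half-isolated zeros and zero-density estimates*, IMRN 2024 =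
  arXiv:2206.11729,

for the weight `w₀ = MaynardPratt.w0` of `HalfIsolatedZero.lean`: the properties of the Mellin
transform `W₀(s) = ∫₀^∞ w₀(x)x^{s−1}dx` used in the proofs of Lemma 15 and Proposition 16. `W₀` is
written with Mathlib's `mellin` as `mellin (fun x : ℝ ↦ ((w0 x : ℝ) : ℂ))` (no new definition).

## Main results (namespace `Literature.NumberTheory.LFunctions.MaynardPratt`)

* `W0_eq_intervalIntegral` — `W₀(s) = ∫_{1/2}^2 x^{s−1} w₀(x) dx`; `norm_W0_le` — `|W₀(s)| ≤ 3·2^{|σ|}`.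
* `W0_zero` — **`W₀(0) = log 2`**.
* `norm_W0_sub_log_two_le` — `|W₀(s) − log 2| ≤ 5|s|` for `|s| ≤ 1`.
* `prod_mul_W0_eq` — repeated integration by parts,
  `(∏_{j<k}(s+j)) W₀(s) = (−1)ᵏ ∫_{1/2}^2 w₀^{(k)}(x) x^{s+k−1} dx`;
  `norm_W0_le_of_im_ne_zero` — `|W₀(s)| ≤ 2^{|σ|}2^{k+1}k!(3k/e)ᵏ/(C|t|^{k+1})` for every `k`.
* `exists_norm_W0_le_div_one_add_sq` — `|W₀(σ+it)| ≤ C 2^{|σ|}/(1+t²)`.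
* `exists_norm_W0_le_exp_neg_sqrt` — **`|W₀(σ+it)| ≤ C 2^{|σ|} e^{−(4/5)√|t|}`** (the printed
  `2^{|σ|}e^{−√(|t|/2)}` has the constant `1/√2 = 0.707…`; we obtain `2/√6 = 0.816…` from the Gevrey
  bound of `HalfIsolatedZeroDerivBounds.lean` and round down to `4/5`; what Proposition 16 needs is
  a constant `> 1/2`, see the docstring of `MaynardPratt2024_prop16`).

## References

* J. Maynard, K. Pratt, IMRN 2024:19, 12978–13014 = arXiv:2206.11729, Lemma 43 (p. 25) and the
  proof of Lemma 15 (p. 10). (`MaynardPratt2024`)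
-/

noncomputable section

open Complex Real Set Filter Metric MeasureTheory
open scoped Topology Nat

namespace Literature.NumberTheory.LFunctions

namespace MaynardPratt

/-! ## The Mellin transform `W₀` -/

/-- The Mellin transform `W₀(s) = ∫₀^∞ w₀(x) x^{s−1} dx` of `w₀` (Mathlib's `mellin` of
`x ↦ (w₀ x : ℂ)`) is the integral over `[1/2, 2]`. [cite: MaynardPratt2024, Lemma 43] -/
theorem W0_eq_intervalIntegral (s : ℂ) :
    mellin (fun x : ℝ ↦ ((w0 x : ℝ) : ℂ)) s = ∫ x in (1 / 2 : ℝ)..2, (x : ℂ) ^ (s - 1) * (w0 x : ℂ) := by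
  rw [mellin, intervalIntegral.integral_of_le (by norm_num : (1 / 2 : ℝ) ≤ 2)]
  simp_rw [smul_eq_mul]
  refine setIntegral_eq_of_subset_of_forall_sdiff_eq_zero measurableSet_Ioi ?_ ?_
  · intro x hx
    exact lt_trans (by norm_num) hx.1
  · rintro x ⟨-, hn⟩
    rw [mem_Ioc, not_and_or, not_lt, not_le] at hn
    rcases hn with h | h
    · simp [w0_of_le_half h]
    · simp [w0_of_two_le h.le]

/-- `x^σ ≤ 2^{|σ|}` for `x ∈ [1/2, 2]`. [folklore] -/
theorem rpow_le_two_pow_abs {x : ℝ} (h1 : 1 / 2 ≤ x) (h2 : x ≤ 2) (σ : ℝ) :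
    x ^ σ ≤ (2 : ℝ) ^ |σ| := by
  have hx : 0 < x := by linarith
  rcases le_or_gt 0 σ with h | h
  · rw [abs_of_nonneg h]
    exact Real.rpow_le_rpow hx.le h2 h
  · rw [abs_of_neg h]
    have hinv : x⁻¹ ≤ 2 := by rw [inv_le_comm₀ hx two_pos]; linarith
    calc x ^ σ = x⁻¹ ^ (-σ) := by
          rw [Real.inv_rpow hx.le, Real.rpow_neg hx.le, inv_inv]
      _ ≤ 2 ^ (-σ) := Real.rpow_le_rpow (inv_nonneg.2 hx.le) hinv (by linarith)

/-- `|x^w| ≤ 2^{|Re w|}` for `x ∈ [1/2, 2]`. [folklore] -/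
theorem norm_cpow_le_two_pow_abs {x : ℝ} (h1 : 1 / 2 ≤ x) (h2 : x ≤ 2) (w : ℂ) :
    ‖(x : ℂ) ^ w‖ ≤ (2 : ℝ) ^ |w.re| := by
  rw [Complex.norm_cpow_eq_rpow_re_of_pos (by linarith)]
  exact rpow_le_two_pow_abs h1 h2 _

/-- `|x^{s−1}| ≤ 2 · 2^{|Re s|}` for `x ∈ [1/2, 2]`. [folklore] -/
theorem norm_cpow_sub_one_le {x : ℝ} (h1 : 1 / 2 ≤ x) (h2 : x ≤ 2) (s : ℂ) :
    ‖(x : ℂ) ^ (s - 1)‖ ≤ 2 * (2 : ℝ) ^ |s.re| := by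
  have hx : 0 < x := by linarith
  rw [Complex.norm_cpow_eq_rpow_re_of_pos hx, sub_re, one_re, Real.rpow_sub_one hx.ne']
  rw [div_le_iff₀ hx]
  calc x ^ s.re ≤ 2 ^ |s.re| := rpow_le_two_pow_abs h1 h2 _
    _ = 2 * 2 ^ |s.re| * (1 / 2) := by ring
    _ ≤ 2 * 2 ^ |s.re| * x := by gcongr

/-- The trivial bound `|W₀(s)| ≤ 3 · 2^{|Re s|}` (Lemma 43: "`|W₀(s)| ≤ 2^{|σ|} ∫ w₀(x)dx/x`";
here `∫_{1/2}^2 2 dx = 3`). [cite: MaynardPratt2024, Lemma 43] -/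
theorem norm_W0_le (s : ℂ) : ‖mellin (fun x : ℝ ↦ ((w0 x : ℝ) : ℂ)) s‖ ≤ 3 * (2 : ℝ) ^ |s.re| := by
  rw [W0_eq_intervalIntegral]
  have h := intervalIntegral.norm_integral_le_of_norm_le_const (a := (1 / 2 : ℝ)) (b := 2)
    (C := 2 * (2 : ℝ) ^ |s.re|) (f := fun x : ℝ ↦ (x : ℂ) ^ (s - 1) * (w0 x : ℂ)) ?_
  · refine h.trans (le_of_eq ?_)
    rw [show |(2 : ℝ) - 1 / 2| = 3 / 2 by norm_num]
    ring
  · intro x hx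
    rw [Set.uIoc_of_le (by norm_num : (1 / 2 : ℝ) ≤ 2)] at hx
    rw [norm_mul, Complex.norm_real, Real.norm_of_nonneg (w0_nonneg x)]
    calc ‖(x : ℂ) ^ (s - 1)‖ * w0 x ≤ 2 * 2 ^ |s.re| * 1 := by
          gcongr
          · exact w0_nonneg x
          · exact norm_cpow_sub_one_le hx.1.le hx.2 s
          · exact w0_le_one x
      _ = _ := mul_one _

/-- `w₀(x) = H(2x−1)` for `x ≤ 1`. [cite: MaynardPratt2024, Lemma 43] -/
theorem w0_of_le_one {x : ℝ} (hx : x ≤ 1) : w0 x = w0Step (2 * x - 1) := by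
  rw [w0, w0Step_of_nonpos (y := x - 1) (by linarith), sub_zero]

/-- `w₀(x) = 1 − H(x−1)` for `x ≥ 1`. [cite: MaynardPratt2024, Lemma 43] -/
theorem w0_of_one_le {x : ℝ} (hx : 1 ≤ x) : w0 x = 1 - w0Step (x - 1) := by
  rw [w0, w0Step_of_one_le (by linarith)]

/-- `H` is continuous. [cite: MaynardPratt2024, Lemma 43] -/
theorem continuous_w0Step : Continuous w0Step := differentiable_w0Step.continuous

/-- **`W₀(0) = log 2`** (Lemma 43: `W₀(0) = ∫_{1/2}^1 H(2x−1)dx/x + ∫_1^2 (1 − H(x−1))dx/x` and the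
substitution `x ↦ 2x` identifies `∫_{1/2}^1 H(2x−1)dx/x` with `∫_1^2 H(x−1)dx/x`).
[cite: MaynardPratt2024, Lemma 43] -/
theorem W0_zero : mellin (fun x : ℝ ↦ ((w0 x : ℝ) : ℂ)) 0 = Real.log 2 := by
  rw [W0_eq_intervalIntegral]
  have h1 : ∫ x in (1 / 2 : ℝ)..2, (x : ℂ) ^ ((0 : ℂ) - 1) * (w0 x : ℂ) =
      ∫ x in (1 / 2 : ℝ)..2, ((w0 x / x : ℝ) : ℂ) := by
    refine intervalIntegral.integral_congr fun x _ ↦ ?_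
    simp only [zero_sub, cpow_neg_one]
    push_cast
    ring
  rw [h1, intervalIntegral.integral_ofReal]
  congr 1
  -- the real computation
  have hcont : ∀ a b : ℝ, 0 < a → a ≤ b → ∀ g : ℝ → ℝ, Continuous g →
      IntervalIntegrable (fun x ↦ g x / x) volume a b := by
    intro a b ha hab g hg
    refine ContinuousOn.intervalIntegrable fun x hx ↦ ?_
    rw [uIcc_of_le hab] at hx
    exact (hg.continuousAt.div continuousAt_id (by linarith [hx.1] : x ≠ 0)).continuousWithinAt
  have hsplit : ∫ x in (1 / 2 : ℝ)..2, w0 x / x =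
      (∫ x in (1 / 2 : ℝ)..1, w0 x / x) + ∫ x in (1 : ℝ)..2, w0 x / x :=
    (intervalIntegral.integral_add_adjacent_intervals
      (hcont _ _ (by norm_num) (by norm_num) w0 continuous_w0)
      (hcont _ _ (by norm_num) (by norm_num) w0 continuous_w0)).symm
  have hleft : ∫ x in (1 / 2 : ℝ)..1, w0 x / x = ∫ x in (1 : ℝ)..2, w0Step (x - 1) / x := by
    have heq : ∫ x in (1 / 2 : ℝ)..1, w0 x / x =
        ∫ x in (1 / 2 : ℝ)..1, (fun y ↦ 2 * (w0Step (y - 1) / y)) (2 * x) := by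
      refine intervalIntegral.integral_congr fun x hx ↦ ?_
      rw [uIcc_of_le (by norm_num : (1 / 2 : ℝ) ≤ 1)] at hx
      simp only
      rw [w0_of_le_one hx.2]
      have : (x : ℝ) ≠ 0 := by linarith [hx.1]
      field_simp
    rw [heq, intervalIntegral.integral_comp_mul_left (f := fun y ↦ 2 * (w0Step (y - 1) / y))
      two_ne_zero]
    norm_num
    ring
  have hright : ∫ x in (1 : ℝ)..2, w0 x / x = Real.log 2 - ∫ x in (1 : ℝ)..2, w0Step (x - 1) / x := by
    have heq : ∫ x in (1 : ℝ)..2, w0 x / x = ∫ x in (1 : ℝ)..2, (x⁻¹ - w0Step (x - 1) / x) := by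
      refine intervalIntegral.integral_congr fun x hx ↦ ?_
      rw [uIcc_of_le (by norm_num : (1 : ℝ) ≤ 2)] at hx
      rw [w0_of_one_le hx.1]
      have : (x : ℝ) ≠ 0 := by linarith [hx.1]
      field_simp
    rw [heq, intervalIntegral.integral_sub, integral_inv (by norm_num)]
    · norm_num
    · exact intervalIntegral.intervalIntegrable_inv (fun x hx ↦ by
        rw [uIcc_of_le (by norm_num : (1 : ℝ) ≤ 2)] at hx; linarith [hx.1]) continuousOn_id
    · exact hcont _ _ (by norm_num) (by norm_num) _ (continuous_w0Step.comp (by fun_prop))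
  rw [hsplit, hleft, hright]
  ring

/-- `x ↦ x^w` is interval integrable on `[a, b] ⊂ (0, ∞)`. [folklore] -/
theorem intervalIntegrable_cpow (w : ℂ) {a b : ℝ} (ha : 0 < a) (hab : a ≤ b) :
    IntervalIntegrable (fun x : ℝ ↦ (x : ℂ) ^ w) volume a b := by
  refine ContinuousOn.intervalIntegrable fun x hx ↦ ?_
  rw [uIcc_of_le hab] at hx
  have hx0 : x ≠ 0 := by linarith [hx.1]
  exact (continuousAt_ofReal_cpow_const x w (Or.inr hx0)).continuousWithinAt

/-- `x ↦ x^w g(x)` is interval integrable on `[a, b] ⊂ (0, ∞)` for continuous `g`. [folklore] -/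
theorem intervalIntegrable_cpow_mul {g : ℝ → ℂ} (hg : Continuous g) (w : ℂ) {a b : ℝ}
    (ha : 0 < a) (hab : a ≤ b) :
    IntervalIntegrable (fun x : ℝ ↦ (x : ℂ) ^ w * g x) volume a b := by
  refine ContinuousOn.intervalIntegrable fun x hx ↦ ?_
  rw [uIcc_of_le hab] at hx
  have hx0 : x ≠ 0 := by linarith [hx.1]
  exact ((continuousAt_ofReal_cpow_const x w (Or.inr hx0)).mul hg.continuousAt).continuousWithinAt

/-- `x ↦ g(x) x^w` is interval integrable on `[a, b] ⊂ (0, ∞)` for continuous `g`. [folklore] -/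
theorem intervalIntegrable_mul_cpow {g : ℝ → ℂ} (hg : Continuous g) (w : ℂ) {a b : ℝ}
    (ha : 0 < a) (hab : a ≤ b) :
    IntervalIntegrable (fun x : ℝ ↦ g x * (x : ℂ) ^ w) volume a b := by
  simpa only [mul_comm] using intervalIntegrable_cpow_mul hg w ha hab

/-- **`W₀(s) = W₀(0) + O(|s|)` near `0`**: `|W₀(s) − log 2| ≤ 5|s|` for `|s| ≤ 1`
(from `|x^s − 1| ≤ 2|s log x|`; this is the property "`W(s) = 1 + O(1/log log T)` for
`|s| ≪ 1/log log T`" of `W = W₀/log 2` used in the proof of Lemma 15).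
[cite: MaynardPratt2024, Lemma 15 (proof)] -/
theorem norm_W0_sub_log_two_le {s : ℂ} (hs : ‖s‖ ≤ 1) : ‖mellin (fun x : ℝ ↦ ((w0 x : ℝ) : ℂ)) s - Real.log 2‖ ≤ 5 * ‖s‖ := by
  rw [← W0_zero, W0_eq_intervalIntegral, W0_eq_intervalIntegral, ← intervalIntegral.integral_sub
    (intervalIntegrable_cpow_mul (g := fun x ↦ (w0 x : ℂ))
      (by exact Complex.continuous_ofReal.comp continuous_w0) _ (by norm_num) (by norm_num))
    (intervalIntegrable_cpow_mul (g := fun x ↦ (w0 x : ℂ))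
      (by exact Complex.continuous_ofReal.comp continuous_w0) _ (by norm_num) (by norm_num))]
  have hlog2 : Real.log 2 < 0.6931471808 := Real.log_two_lt_d9
  have h := intervalIntegral.norm_integral_le_of_norm_le_const (a := (1 / 2 : ℝ)) (b := 2)
    (C := 4 * Real.log 2 * ‖s‖)
    (f := fun x : ℝ ↦ (x : ℂ) ^ (s - 1) * (w0 x : ℂ) - (x : ℂ) ^ ((0 : ℂ) - 1) * (w0 x : ℂ)) ?_
  · rw [show |(2 : ℝ) - 1 / 2| = 3 / 2 by norm_num] at h
    refine h.trans ?_
    nlinarith [norm_nonneg s]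
  · intro x hx
    rw [Set.uIoc_of_le (by norm_num : (1 / 2 : ℝ) ≤ 2)] at hx
    have hx0 : 0 < x := by linarith [hx.1]
    have hxC : (x : ℂ) ≠ 0 := by exact_mod_cast hx0.ne'
    -- `x^{s-1} - x^{-1} = x^{-1} (x^s - 1)` and `x^s = exp(s log x)`
    have hfac : (x : ℂ) ^ (s - 1) * (w0 x : ℂ) - (x : ℂ) ^ ((0 : ℂ) - 1) * (w0 x : ℂ) =
        (x : ℂ)⁻¹ * (Complex.exp (s * Real.log x) - 1) * (w0 x : ℂ) := by
      rw [cpow_sub _ _ hxC, cpow_one, zero_sub, cpow_neg_one, cpow_def_of_ne_zero hxC,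
        Complex.ofReal_log hx0.le]
      field_simp
    rw [hfac, norm_mul, norm_mul, norm_inv, Complex.norm_real, Complex.norm_real,
      Real.norm_of_nonneg (w0_nonneg x), Real.norm_of_nonneg hx0.le]
    have hlogx : |Real.log x| ≤ Real.log 2 := by
      rw [abs_le]
      constructor
      · rw [neg_le, ← Real.log_inv]
        exact Real.log_le_log (by positivity) (by rw [inv_le_comm₀ hx0 two_pos]; linarith [hx.1])
      · exact Real.log_le_log hx0 hx.2
    have hsl : ‖s * Real.log x‖ ≤ ‖s‖ * Real.log 2 := by
      rw [norm_mul, Complex.norm_real, Real.norm_eq_abs]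
      gcongr
    have hsl1 : ‖s * Real.log x‖ ≤ 1 := hsl.trans (by nlinarith [norm_nonneg s])
    have hexp := Complex.norm_exp_sub_one_le hsl1
    calc x⁻¹ * ‖Complex.exp (s * Real.log x) - 1‖ * w0 x ≤ 2 * (2 * (‖s‖ * Real.log 2)) * 1 := by
          gcongr
          · exact w0_nonneg x
          · rw [inv_le_comm₀ hx0 two_pos]; linarith [hx.1]
          · exact hexp.trans (by gcongr)
          · exact w0_le_one x
      _ = 4 * Real.log 2 * ‖s‖ := by ring

/-! ## Integration by parts and the decay of `W₀` -/

/-- The derivative of `x ↦ (w₀^{(k)}(x) : ℂ)` is `w₀^{(k+1)}(x)`. [folklore] -/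
theorem hasDerivAt_iteratedDeriv_w0_ofReal (k : ℕ) (x : ℝ) :
    HasDerivAt (fun y : ℝ ↦ ((iteratedDeriv k w0 y : ℝ) : ℂ))
      ((iteratedDeriv (k + 1) w0 x : ℝ) : ℂ) x := by
  have hd : Differentiable ℝ (iteratedDeriv k w0) :=
    contDiff_w0.differentiable_iteratedDeriv k (by exact_mod_cast ENat.coe_lt_top k)
  have := (hd x).hasDerivAt.ofReal_comp
  rwa [← iteratedDeriv_succ] at this

/-- **One integration by parts** (proof of Lemma 43), the boundary terms vanishing because every
derivative of `w₀` vanishes at `1/2` and `2`: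
`∫_{1/2}^2 w₀^{(k)}(x) x^{s+k−1} dx = −(s+k)⁻¹ ∫_{1/2}^2 w₀^{(k+1)}(x) x^{s+k} dx` for `s + k ≠ 0`.
[cite: MaynardPratt2024, Lemma 43] -/
theorem integral_iteratedDeriv_w0_mul_cpow (k : ℕ) {s : ℂ} (hs : s + k ≠ 0) :
    ∫ x in (1 / 2 : ℝ)..2, ((iteratedDeriv k w0 x : ℝ) : ℂ) * (x : ℂ) ^ (s + k - 1) =
      -(s + k)⁻¹ * ∫ x in (1 / 2 : ℝ)..2, ((iteratedDeriv (k + 1) w0 x : ℝ) : ℂ) * (x : ℂ) ^ (s + k) := by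
  have hr : s + k - 1 ≠ -1 := by
    intro h; apply hs; linear_combination h
  have hibp := intervalIntegral.integral_mul_deriv_eq_deriv_mul (a := (1 / 2 : ℝ)) (b := 2)
    (u := fun y : ℝ ↦ ((iteratedDeriv k w0 y : ℝ) : ℂ))
    (u' := fun y : ℝ ↦ ((iteratedDeriv (k + 1) w0 y : ℝ) : ℂ))
    (v := fun y : ℝ ↦ (y : ℂ) ^ (s + k - 1 + 1) / (s + k - 1 + 1))
    (v' := fun y : ℝ ↦ (y : ℂ) ^ (s + k - 1))
    (fun x _ ↦ hasDerivAt_iteratedDeriv_w0_ofReal k x)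
    (fun x hx ↦ by
      rw [uIcc_of_le (by norm_num : (1 / 2 : ℝ) ≤ 2)] at hx
      exact hasDerivAt_ofReal_cpow_const' (by linarith [hx.1]) hr)
    ((Complex.continuous_ofReal.comp (continuous_iteratedDeriv_w0 (k + 1))).intervalIntegrable _ _)
    (intervalIntegrable_cpow _ (by norm_num) (by norm_num))
  simp only [sub_add_cancel] at hibp
  rw [hibp, iteratedDeriv_w0_two, iteratedDeriv_w0_half]
  simp only [Complex.ofReal_zero, zero_mul, sub_zero, zero_sub]
  rw [← intervalIntegral.integral_neg, ← intervalIntegral.integral_const_mul]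
  refine intervalIntegral.integral_congr fun x _ ↦ ?_
  field_simp

/-- **Repeated integration by parts** (Lemma 43:
"`W₀(s) = (−1)ᵏ/(s(s+1)⋯(s+k−1)) ∫₀^∞ w₀^{(k)}(x) x^{s+k−1} dx`"), in product form:
`(∏_{j<k} (s+j)) · W₀(s) = (−1)ᵏ ∫_{1/2}^2 w₀^{(k)}(x) x^{s+k−1} dx` whenever `s + j ≠ 0` for `j < k`.
[cite: MaynardPratt2024, Lemma 43] -/
theorem prod_mul_W0_eq (k : ℕ) {s : ℂ} (hs : ∀ j : ℕ, j < k → s + j ≠ 0) :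
    (∏ j ∈ Finset.range k, (s + j)) * mellin (fun x : ℝ ↦ ((w0 x : ℝ) : ℂ)) s =
      (-1) ^ k * ∫ x in (1 / 2 : ℝ)..2, ((iteratedDeriv k w0 x : ℝ) : ℂ) * (x : ℂ) ^ (s + k - 1) := by
  induction k with
  | zero =>
    simp only [Finset.range_zero, Finset.prod_empty, one_mul, pow_zero, iteratedDeriv_zero,
      Nat.cast_zero, add_zero, W0_eq_intervalIntegral]
    exact intervalIntegral.integral_congr fun x _ ↦ mul_comm _ _
  | succ k ih =>
    have hs' : ∀ j : ℕ, j < k → s + j ≠ 0 := fun j hj ↦ hs j (Nat.lt_succ_of_lt hj)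
    have hsk : s + k ≠ 0 := hs k (Nat.lt_succ_self k)
    rw [Finset.prod_range_succ, mul_comm _ (s + k), mul_assoc, ih hs',
      integral_iteratedDeriv_w0_mul_cpow k hsk]
    push_cast
    rw [show s + (k + 1) - 1 = s + k by ring]
    field_simp
    ring

/-- The `(k+1)`-fold integrated integral is bounded by
`|∫_{1/2}^2 w₀^{(k+1)}(x) x^{s+k} dx| ≤ 2^{|σ|} · 2^{k+1} k!(3k/e)ᵏ / C`
(split at `x = 1`: on `[1/2,1]` the chain-rule factor `2^{k+1}` meets `xᵏ ≤ 1`, on `[1,2]` there is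
no chain-rule factor and `xᵏ ≤ 2ᵏ`). [cite: MaynardPratt2024, Lemma 43] -/
theorem norm_integral_iteratedDeriv_succ_w0_le (k : ℕ) (s : ℂ) :
    ‖∫ x in (1 / 2 : ℝ)..2, ((iteratedDeriv (k + 1) w0 x : ℝ) : ℂ) * (x : ℂ) ^ (s + k)‖ ≤
      (2 : ℝ) ^ |s.re| * 2 ^ (k + 1) * (k ! * (3 * k / Real.exp 1) ^ k) / w0Const := by
  set G : ℝ := k ! * (3 * k / Real.exp 1) ^ k with hG
  have hG0 : 0 ≤ G := by positivity
  have hC := w0Const_pos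
  have hint : ∀ a b : ℝ, 0 < a → a ≤ b → IntervalIntegrable
      (fun x : ℝ ↦ ((iteratedDeriv (k + 1) w0 x : ℝ) : ℂ) * (x : ℂ) ^ (s + k)) volume a b :=
    fun a b ha hab ↦ intervalIntegrable_mul_cpow
      (Complex.continuous_ofReal.comp (continuous_iteratedDeriv_w0 (k + 1))) _ ha hab
  rw [← intervalIntegral.integral_add_adjacent_intervals (b := 1)
    (hint _ _ (by norm_num) (by norm_num)) (hint _ _ (by norm_num) (by norm_num))]
  -- left piece
  have hL := intervalIntegral.norm_integral_le_of_norm_le_const (a := (1 / 2 : ℝ)) (b := 1)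
    (C := 2 ^ (k + 1) * G / w0Const * (2 : ℝ) ^ |s.re|)
    (f := fun x : ℝ ↦ ((iteratedDeriv (k + 1) w0 x : ℝ) : ℂ) * (x : ℂ) ^ (s + k)) (by
      intro x hx
      rw [Set.uIoc_of_le (by norm_num : (1 / 2 : ℝ) ≤ 1)] at hx
      have hx0 : 0 < x := by linarith [hx.1]
      rw [norm_mul, Complex.norm_real, Complex.norm_cpow_eq_rpow_re_of_pos hx0, add_re,
        natCast_re, Real.rpow_add_natCast hx0.ne']
      calc ‖iteratedDeriv (k + 1) w0 x‖ * (x ^ s.re * x ^ k)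
          ≤ (2 ^ (k + 1) * G / w0Const) * ((2 : ℝ) ^ |s.re| * 1) := by
            gcongr
            · exact norm_iteratedDeriv_succ_w0_le_of_le_one k hx.2
            · exact rpow_le_two_pow_abs hx.1.le (by linarith [hx.2]) _
            · exact pow_le_one₀ hx0.le hx.2
        _ = _ := by ring)
  -- right piece
  have hR := intervalIntegral.norm_integral_le_of_norm_le_const (a := (1 : ℝ)) (b := 2)
    (C := G / w0Const * ((2 : ℝ) ^ |s.re| * 2 ^ k))
    (f := fun x : ℝ ↦ ((iteratedDeriv (k + 1) w0 x : ℝ) : ℂ) * (x : ℂ) ^ (s + k)) (by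
      intro x hx
      rw [Set.uIoc_of_le (by norm_num : (1 : ℝ) ≤ 2)] at hx
      have hx0 : 0 < x := by linarith [hx.1]
      rw [norm_mul, Complex.norm_real, Complex.norm_cpow_eq_rpow_re_of_pos hx0, add_re,
        natCast_re, Real.rpow_add_natCast hx0.ne']
      gcongr
      · exact norm_iteratedDeriv_succ_w0_le_of_one_le k hx.1.le
      · exact rpow_le_two_pow_abs (by linarith [hx.1]) hx.2 _
      · exact hx.2)
  refine (norm_add_le _ _).trans ((add_le_add hL hR).trans (le_of_eq ?_))
  rw [show |(1 : ℝ) - 1 / 2| = 1 / 2 by norm_num, show |(2 : ℝ) - 1| = 1 by norm_num]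
  ring

/-- `|Im s|ᵏ ≤ |∏_{j<k} (s + j)|` (each factor has modulus `≥ |Im s|`). [folklore] -/
theorem abs_im_pow_le_norm_prod (k : ℕ) (s : ℂ) :
    |s.im| ^ k ≤ ‖∏ j ∈ Finset.range k, (s + j)‖ := by
  rw [norm_prod]
  calc |s.im| ^ k = ∏ _j ∈ Finset.range k, |s.im| := by simp
    _ ≤ ∏ j ∈ Finset.range k, ‖s + (j : ℂ)‖ :=
        Finset.prod_le_prod (fun _ _ ↦ abs_nonneg _) fun j _ ↦ by
          simpa using Complex.abs_im_le_norm (s + j)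

/-- **Polynomial decay of `W₀` of every order** (Lemma 43: "`|W₀(s)| ≪ 2^{|σ|}(8k²/(e²|t|))ᵏ`"):
for `Im s ≠ 0` and every `k`, `|W₀(s)| ≤ 2^{|σ|} 2^{k+1} k!(3k/e)ᵏ / (C |Im s|^{k+1})`.
[cite: MaynardPratt2024, Lemma 43] -/
theorem norm_W0_le_of_im_ne_zero (k : ℕ) {s : ℂ} (hs : s.im ≠ 0) :
    ‖mellin (fun x : ℝ ↦ ((w0 x : ℝ) : ℂ)) s‖ ≤ (2 : ℝ) ^ |s.re| * 2 ^ (k + 1) * (k ! * (3 * k / Real.exp 1) ^ k) / w0Const /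
      |s.im| ^ (k + 1) := by
  have hne : ∀ j : ℕ, j < k + 1 → s + j ≠ 0 := by
    intro j _ h
    apply hs
    simpa using congrArg Complex.im h
  have key := prod_mul_W0_eq (k + 1) hne
  have hfun : (fun x : ℝ ↦ ((iteratedDeriv (k + 1) w0 x : ℝ) : ℂ) * (x : ℂ) ^ (s + ↑(k + 1) - 1)) =
      fun x : ℝ ↦ ((iteratedDeriv (k + 1) w0 x : ℝ) : ℂ) * (x : ℂ) ^ (s + k) := by
    ext x; push_cast; ring_nf
  rw [hfun] at key
  have hnorm := congrArg norm key
  rw [norm_mul, norm_mul, norm_pow, norm_neg, norm_one, one_pow, one_mul] at hnorm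
  have hprod := abs_im_pow_le_norm_prod (k + 1) s
  have htpos : 0 < |s.im| ^ (k + 1) := pow_pos (abs_pos.2 hs) _
  rw [le_div_iff₀ htpos]
  calc ‖mellin (fun x : ℝ ↦ ((w0 x : ℝ) : ℂ)) s‖ * |s.im| ^ (k + 1) ≤ ‖mellin (fun x : ℝ ↦ ((w0 x : ℝ) : ℂ)) s‖ * ‖∏ j ∈ Finset.range (k + 1), (s + j)‖ := by gcongr
    _ = ‖∫ x in (1 / 2 : ℝ)..2, ((iteratedDeriv (k + 1) w0 x : ℝ) : ℂ) * (x : ℂ) ^ (s + k)‖ := by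
        rw [mul_comm, hnorm]
    _ ≤ _ := norm_integral_iteratedDeriv_succ_w0_le k s

/-- **`W₀(s) ≪ 2^{|σ|}/(1 + t²)`** (`s = σ + it`) with an absolute constant (the decay
`|W(s)| ≪ min(1, |s|⁻²)` on vertical strips required of `W` in Lemma 15, for `W = W₀/log 2`).
[cite: MaynardPratt2024, Lemma 43] -/
theorem exists_norm_W0_le_div_one_add_sq :
    ∃ C : ℝ, 0 < C ∧ ∀ s : ℂ, ‖mellin (fun x : ℝ ↦ ((w0 x : ℝ) : ℂ)) s‖ ≤ C * (2 : ℝ) ^ |s.re| / (1 + s.im ^ 2) := by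
  have hC := w0Const_pos
  have he := Real.exp_pos 1
  refine ⟨6 + 24 / (Real.exp 1 * w0Const), by positivity, fun s ↦ ?_⟩
  have h2 : (0 : ℝ) < 2 ^ |s.re| := by positivity
  rcases le_or_gt |s.im| 1 with ht | ht
  · have hsq : s.im ^ 2 ≤ 1 := by
      rw [← sq_abs]; exact pow_le_one₀ (abs_nonneg _) ht
    calc ‖mellin (fun x : ℝ ↦ ((w0 x : ℝ) : ℂ)) s‖ ≤ 3 * 2 ^ |s.re| := norm_W0_le s
      _ = 6 * 2 ^ |s.re| / 2 := by ring
      _ ≤ 6 * 2 ^ |s.re| / (1 + s.im ^ 2) := by gcongr; linarith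
      _ ≤ (6 + 24 / (Real.exp 1 * w0Const)) * 2 ^ |s.re| / (1 + s.im ^ 2) := by
          gcongr; linarith [show 0 < 24 / (Real.exp 1 * w0Const) by positivity]
  · have hs : s.im ≠ 0 := by intro h0; rw [h0, abs_zero] at ht; linarith
    have h := norm_W0_le_of_im_ne_zero 1 hs
    have ht2 : 1 + s.im ^ 2 ≤ 2 * |s.im| ^ 2 := by
      have h1 : 1 < |s.im| ^ 2 := by nlinarith
      rw [sq_abs] at h1 ⊢; linarith
    have htpos : 0 < |s.im| := abs_pos.2 hs
    calc ‖mellin (fun x : ℝ ↦ ((w0 x : ℝ) : ℂ)) s‖ ≤ 2 ^ |s.re| * 2 ^ (1 + 1) * ((1 : ℕ) ! * (3 * ((1 : ℕ) : ℝ) / Real.exp 1) ^ 1) /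
          w0Const / |s.im| ^ (1 + 1) := h
      _ = 24 / (Real.exp 1 * w0Const) * 2 ^ |s.re| / (2 * |s.im| ^ 2) := by
          simp only [Nat.factorial_one, Nat.cast_one, pow_one]
          field_simp
          ring
      _ ≤ 24 / (Real.exp 1 * w0Const) * 2 ^ |s.re| / (1 + s.im ^ 2) := by gcongr
      _ ≤ (6 + 24 / (Real.exp 1 * w0Const)) * 2 ^ |s.re| / (1 + s.im ^ 2) := by
          gcongr; linarith

/-- `(4/5)√t ≤ 2√(t/6)` (`16/25 ≤ 2/3`). [folklore] -/
theorem four_fifths_sqrt_le {t : ℝ} (ht : 0 ≤ t) : 4 / 5 * √t ≤ 2 * √(t / 6) := by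
  rw [show (4 / 5 : ℝ) = √((4 / 5) ^ 2) by rw [Real.sqrt_sq (by norm_num)],
    show (2 : ℝ) = √(2 ^ 2) by rw [Real.sqrt_sq (by norm_num)], ← Real.sqrt_mul (sq_nonneg _),
    ← Real.sqrt_mul (sq_nonneg _)]
  exact Real.sqrt_le_sqrt (by nlinarith)

/-- **Sub-exponential decay of `W₀`** (Lemma 43: "`|W₀(σ+it)| ≪ 2^{|σ|} exp(−√(|t|/2))`
uniformly in `σ` and `t`"), here with the exponent constant `4/5 > 1/√2` (choosing
`k + 1 = ⌊√(|t|/6)⌋` integrations by parts; any constant `> 1/2` serves Proposition 16):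
there is an absolute `C` with `|W₀(σ + it)| ≤ C 2^{|σ|} e^{−(4/5)√|t|}` for all `σ, t`.
[cite: MaynardPratt2024, Lemma 43] -/
theorem exists_norm_W0_le_exp_neg_sqrt :
    ∃ C : ℝ, 0 < C ∧ ∀ s : ℂ,
      ‖mellin (fun x : ℝ ↦ ((w0 x : ℝ) : ℂ)) s‖ ≤ C * (2 : ℝ) ^ |s.re| * Real.exp (-(4 / 5 * √|s.im|)) := by
  have hC := w0Const_pos
  have he := Real.exp_pos 1
  have he2 : Real.exp 1 ^ 2 = Real.exp 2 := by rw [← Real.exp_nat_mul]; norm_num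
  refine ⟨Real.exp 1 ^ 5 / (3 * w0Const) + 3 * Real.exp 1 ^ 2, by positivity, fun s ↦ ?_⟩
  set t := |s.im| with ht_def
  have ht0 : 0 ≤ t := abs_nonneg _
  have h2 : (0 : ℝ) < 2 ^ |s.re| := by positivity
  rcases lt_or_ge t 6 with ht | ht
  · -- small `t`: the trivial bound
    have hsq : √t < 5 / 2 := by
      rw [Real.sqrt_lt' (by norm_num)]; linarith
    have hexp : 1 ≤ Real.exp 1 ^ 2 * Real.exp (-(4 / 5 * √t)) := by
      rw [he2, ← Real.exp_add, Real.one_le_exp_iff]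
      linarith
    calc ‖mellin (fun x : ℝ ↦ ((w0 x : ℝ) : ℂ)) s‖ ≤ 3 * 2 ^ |s.re| := norm_W0_le s
      _ ≤ 3 * 2 ^ |s.re| * (Real.exp 1 ^ 2 * Real.exp (-(4 / 5 * √t))) :=
          le_mul_of_one_le_right (by positivity) hexp
      _ = 3 * Real.exp 1 ^ 2 * 2 ^ |s.re| * Real.exp (-(4 / 5 * √t)) := by ring
      _ ≤ (Real.exp 1 ^ 5 / (3 * w0Const) + 3 * Real.exp 1 ^ 2) * 2 ^ |s.re| *
            Real.exp (-(4 / 5 * √t)) := by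
          gcongr; linarith [show 0 < Real.exp 1 ^ 5 / (3 * w0Const) by positivity]
  · -- large `t`: `k + 1 = ⌊√(t/6)⌋` integrations by parts
    set n := ⌊√(t / 6)⌋₊ with hn_def
    have hsq1 : 1 ≤ √(t / 6) := by
      rw [Real.le_sqrt (by norm_num) (by positivity)]; linarith
    have hn1 : 1 ≤ n := Nat.floor_pos.2 hsq1
    obtain ⟨k, hk⟩ : ∃ k, n = k + 1 := ⟨n - 1, by omega⟩
    have hnle : (n : ℝ) ≤ √(t / 6) := Nat.floor_le (Real.sqrt_nonneg _)
    have hnlt : √(t / 6) < n + 1 := Nat.lt_floor_add_one _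
    have hs : s.im ≠ 0 := by
      intro h0; rw [ht_def, h0, abs_zero] at ht; linarith
    have h := norm_W0_le_of_im_ne_zero k hs
    rw [← ht_def] at h
    have hG := two_pow_mul_gevrey_le k
    have hkn : ((k : ℝ) + 1) = n := by rw [hk]; push_cast; ring
    rw [hkn, ← hk] at hG
    -- `6 n² ≤ t`
    have h6n : 6 * (n : ℝ) ^ 2 ≤ t := by
      have h1 : (n : ℝ) ^ 2 ≤ √(t / 6) ^ 2 := pow_le_pow_left₀ (Nat.cast_nonneg n) hnle 2
      rw [Real.sq_sqrt (by positivity)] at h1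
      linarith
    have htpos : 0 < t := by linarith
    have hratio : 6 * (n : ℝ) ^ 2 / Real.exp 1 ^ 2 / t ≤ (Real.exp 1 ^ 2)⁻¹ := by
      rw [div_div, div_le_iff₀ (by positivity)]
      field_simp
      linarith
    have hpow : (6 * (n : ℝ) ^ 2 / Real.exp 1 ^ 2 / t) ^ n ≤ ((Real.exp 1 ^ 2)⁻¹) ^ n :=
      pow_le_pow_left₀ (by positivity) hratio n
    have hexp1 : ((Real.exp 1 ^ 2)⁻¹) ^ n = Real.exp (-(2 * n)) := by
      rw [he2, ← Real.exp_neg, ← Real.exp_nat_mul]; ring_nf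
    have hexp2 : Real.exp (-(2 * n)) ≤ Real.exp 1 ^ 2 * Real.exp (-(4 / 5 * √t)) := by
      rw [he2, ← Real.exp_add, Real.exp_le_exp]
      have h45 := four_fifths_sqrt_le ht0
      linarith
    -- assemble
    have hmain : (2 : ℝ) ^ (k + 1) * (k ! * (3 * k / Real.exp 1) ^ k) / t ^ (k + 1) ≤
        Real.exp 1 ^ 3 / 3 * (Real.exp 1 ^ 2 * Real.exp (-(4 / 5 * √t))) := by
      rw [div_le_iff₀ (by positivity), ← hk]
      calc (2 : ℝ) ^ n * (k ! * (3 * k / Real.exp 1) ^ k)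
          ≤ Real.exp 1 ^ 3 / 3 * (6 * (n : ℝ) ^ 2 / Real.exp 1 ^ 2) ^ n := hG
        _ = Real.exp 1 ^ 3 / 3 * (6 * (n : ℝ) ^ 2 / Real.exp 1 ^ 2 / t) ^ n * t ^ n := by
            rw [div_pow _ t, mul_assoc, div_mul_cancel₀ _ (pow_ne_zero _ htpos.ne')]
        _ ≤ Real.exp 1 ^ 3 / 3 * (Real.exp 1 ^ 2 * Real.exp (-(4 / 5 * √t))) * t ^ n := by
            gcongr
            calc (6 * (n : ℝ) ^ 2 / Real.exp 1 ^ 2 / t) ^ n ≤ ((Real.exp 1 ^ 2)⁻¹) ^ n := hpow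
              _ = Real.exp (-(2 * n)) := hexp1
              _ ≤ _ := hexp2
    calc ‖mellin (fun x : ℝ ↦ ((w0 x : ℝ) : ℂ)) s‖ ≤ 2 ^ |s.re| * 2 ^ (k + 1) * (k ! * (3 * k / Real.exp 1) ^ k) / w0Const /
          t ^ (k + 1) := h
      _ = 2 ^ |s.re| / w0Const * (2 ^ (k + 1) * (k ! * (3 * k / Real.exp 1) ^ k) / t ^ (k + 1)) := by
          ring
      _ ≤ 2 ^ |s.re| / w0Const * (Real.exp 1 ^ 3 / 3 * (Real.exp 1 ^ 2 * Real.exp (-(4 / 5 * √t)))) := by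
          gcongr
      _ = Real.exp 1 ^ 5 / (3 * w0Const) * 2 ^ |s.re| * Real.exp (-(4 / 5 * √t)) := by
          field_simp
      _ ≤ (Real.exp 1 ^ 5 / (3 * w0Const) + 3 * Real.exp 1 ^ 2) * 2 ^ |s.re| *
            Real.exp (-(4 / 5 * √t)) := by
          gcongr; linarith [show 0 < 3 * Real.exp 1 ^ 2 by positivity]

end MaynardPratt

end Literature.NumberTheory.LFunctions
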